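import Mathlib.NumberTheory.LSeries.RiemannZeta
import Mathlib.Analysis.Calculus.Deriv.Basic
import Literature.NumberTheory.LFunctions.RiemannXi
import HarnessLib

/-!
# Barrier: de Branges' positivity conditions fail for `ζ` (Conrey–Li 2000)

Barrier catalogue `Literature/Barriers/RiemannHypothesis/` (D-0021), entry `DeBrangesPositivity`
(namespace `Literature.Barriers.RiemannHypothesis`; the catalogued declaration is `DeBrangesPositivity`, the
conjunction of the two printed failures `ConreyLi2000_HE` and `ConreyLi2000_FW`).

## The technique (de Branges 1986, 1992; as restated and proved in Conrey–Li 2000, §2)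

For an entire `E` with `|E(z̄)| < |E(z)|` on `Im z > 0`, the de Branges space `𝓗(E)` is the
Hilbert space of entire `F` with `F/E ∈ L²(ℝ)` and `|F(z)|² ≤ ‖F‖² K(z,z)`, with reproducing kernel
`K(w,z) = (E(z) conj(E(w)) − E♯(z) E(w̄)) / (2πi (w̄ − z))`, `E♯(z) = conj(E(z̄))`.

* **Theorem 1** (Conrey–Li 2000, Thm. 1, "essentially due to de Branges"). Let `E` have no real
  zeros, `|E(z̄)| < |E(z)|` for `Im z > 0`, `E♯(z) = ε E(z − i)` with `|ε| = 1`, and `|E(x+iy)|`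
  strictly increasing in `y > 0`. If `Re ⟨F(z), F(z+i)⟩_{𝓗(E)} ≥ 0` for every `F ∈ 𝓗(E)` with
  `F(z+i) ∈ 𝓗(E)` (condition (3.1)), then the zeros of `E` lie on `Im z = −1/2`, **and**
  `Re { conj(E′(w)) E(w+i) / 2πi } ≥ 0` at every zero `w` of `E`.
* **Theorem 2** (Conrey–Li 2000, Thm. 2). Let `W` be analytic and zero-free on `Im z > 0` and let
  `T : 𝓕(W) → 𝓕(W)` send `K(w,z) ↦ K(w+i,z)`. If `Re ⟨F, TF⟩_{𝓕(W)} ≥ 0` for all `F` (condition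
  (3.3)), then `W` extends analytically to `Im z > −1/2` **and** `Re { W(z)/W(z+i) } ≥ 0` there.

With `E(z) = ξ(1 − iz)` (resp. `W(z) = 1/ξ(1 − iz)`), where `ξ(s) = s(s−1)π^{−s/2}Γ(s/2)ζ(s)` is
twice Riemann's `ξ` (`Literature.NumberTheory.LFunctions.riemannXi`), condition (3.1) (resp. (3.3)) would imply the Riemann
hypothesis (Conrey–Li 2000, §3.1). Under `s = 1 − iz` the necessary conditions printed in the two
theorems read: `Re { conj(ξ′(ρ)) ξ(1+ρ) } ≥ 0` at every zero `ρ` of `ξ` (Thm. 1; for `ρ` on the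
critical line `conj(ξ′(ρ)) = −ξ′(ρ)`, giving the paper's `−Re{ξ′(ρ)ξ(1+ρ)} ≥ 0`), and
`Re { ξ(s)/ξ(s+1) } ≥ 0` for `Re s > 1/2` (Thm. 2; `W(z)/W(z+i) = ξ(s+1)/ξ(s)`, and `Re u` and
`Re u⁻¹` have the same sign). Both are insensitive to the factor `2` between the paper's `ξ` and
`Literature.NumberTheory.LFunctions.riemannXi` (a product scales by `4`, a ratio by `1`).

## The obstruction (what this file vendors)

* `ConreyLi2000_HE` — §3.1, (3.2): at the zero `ρ = 1/2 + i·111.0295355431696745…` of `ζ`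
  (the 34th), `−Re{ξ′(ρ)ξ(1+ρ)} = −5.3891…·10⁻⁶⁹ < 0` (MATHEMATICA evaluation as printed); hence,
  by Theorem 1, `𝓗(ξ(1−iz))` violates (3.1).
* `ConreyLi2000_FW_numeric` — §3.1, (3.4): `Re{ξ(1+282i)/ξ(2+282i)} = −0.000131957 < 0`
  (MATHEMATICA evaluation as printed); hence, by Theorem 2, `𝓕(1/ξ(1−iz))` violates (3.3).
* `ConreyLi2000_FW` — §4, Remark (P. Sarnak's proof, no numerics): there is `s₀` with
  `Re s₀ > 1/2` and `Re{ξ(s₀)/ξ(s₀+1)} < 0`, from Bohr's density theorem for `log ζ(s)` in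
  `1/2 < Re s < 2` (Titchmarsh 1986, Ch. XI). `ConreyLi2000_FW_numeric → ConreyLi2000_FW` is proved.
* The same failures for `L(s, χ₄)` (§3.2: zero `1/2 + i·67.63692…`, value `−2.31…·10⁻⁴⁵`; and
  `Re{ξ(1+8714.2i, χ₄)/ξ(2+8714.2i, χ₄)} = −0.000422… < 0`), and Sarnak's extension to every
  Dirichlet character (§4), are recorded here only informally (this catalogue entry is for `ζ`).

The de Branges spaces `𝓗(E)`, `𝓕(W)` themselves are not formalised (no Mathlib support for
Hilbert spaces of entire functions; searched `deBranges`, `HermiteBiehler`, `reproducingKernel`):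
the vendored Props are the printed *necessary conditions* of Theorems 1–2 and their printed
failures, which is the checkable content of the barrier.

## References

* [ConreyLi2000] J. B. Conrey, X.-J. Li, *A note on some positivity conditions related to zeta and
  L-functions*, IMRN 2000, no. 18, 929–940; arXiv:math/9812166 (read: Thm. 1, Thm. 2, §3.1
  (3.1)–(3.4), §3.2, §4 Conclusion and Remark).
* [deBranges1986] L. de Branges, *The Riemann hypothesis for Hilbert spaces of entire functions*,
  Bull. AMS 15 (1986), 1–17. [deBranges1992] L. de Branges, *The convergence of Euler products*,
  J. Funct. Anal. 107 (1992), 122–210. (Cited through [ConreyLi2000] refs. [2], [3].)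
* [Lagarias2005] J. C. Lagarias, *Zero spacing distributions for differenced L-functions*, Acta
  Arith. 120 (2005), 159–184, §7 (end): summary of the obstruction and of Li's examples of spaces
  that do satisfy de Branges' conditions.
* [Titchmarsh1986] E. C. Titchmarsh, *The theory of the Riemann zeta-function*, 2nd ed., Ch. XI.
-/

noncomputable section

open Complex

namespace Literature.Barriers.RiemannHypothesis

/-- **Conrey–Li 2000, §3.1 eq. (3.2): de Branges' `𝓗(E)`-positivity fails for `ζ`.** There is a
zero `ρ` of `ξ` on the critical line with ordinate in `(111, 111.5)` — the paper's
`ρ = 1/2 + i·111.0295355431696745…`, the 34th zero of `ζ` (the only zero in that window; the 35th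
has ordinate `111.8747…`) — at which `Re { conj(ξ′(ρ)) · ξ(1 + ρ) } < 0`; as printed,
`−Re{ξ′(ρ) ξ(1+ρ)} = −5.389100507182945…·10⁻⁶⁹ < 0` (a MATHEMATICA evaluation; on the critical
line `conj(ξ′(ρ)) = −ξ′(ρ)`, and the sign is unchanged under the paper's normalisation
`ξ = 2·Literature.riemannXi`). By Conrey–Li's Theorem 1 (de Branges), positivity condition (3.1) for
`𝓗(ξ(1 − iz))` forces `Re{conj(ξ′(ρ))ξ(1+ρ)} ≥ 0` at every zero, so (3.1) fails.
[cite: ConreyLi2000, §3.1 (3.2)] -/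
def ConreyLi2000_HE : Prop :=
  ∃ ρ : ℂ, Literature.NumberTheory.LFunctions.riemannXi ρ = 0 ∧ ρ.re = 1 / 2 ∧ 111 < ρ.im ∧ ρ.im < 111.5 ∧
    (starRingEnd ℂ (deriv Literature.NumberTheory.LFunctions.riemannXi ρ) * Literature.NumberTheory.LFunctions.riemannXi (1 + ρ)).re < 0

/-- **Conrey–Li 2000, §4 Remark (proof due to P. Sarnak): de Branges' `𝓕(W)`-positivity fails for
`ζ`, without numerics.** There is `s₀` with `Re s₀ > 1/2` and `Re{ξ(s₀)/ξ(s₀+1)} < 0`. Printed proof: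
`Im log(ξ(s)/ξ(s+1)) = Im log ζ(s) + O(1)` on `Re s > 1/2`, and the values of `log ζ(s)` on
`1/2 < Re s < 2` are dense in `ℂ` (Bohr; Titchmarsh Ch. XI), so some `s₀` has
`π/2 < Im log(ξ(s₀)/ξ(s₀+1)) < π`. With `W(z) = 1/ξ(1 − iz)` and `z₀ = i(s₀ − 1)` this gives
`Im z₀ > −1/2` and `Re{W(z₀)/W(z₀+i)} < 0`, so by Conrey–Li's Theorem 2 the space `𝓕(W)` violates
positivity condition (3.3) — the condition that would have given `ζ(s) ≠ 0` for `Re s > 1/2`; the same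
argument covers every Dirichlet `L(s, χ)` (§4). [cite: ConreyLi2000, §4 Remark]
[cite: Titchmarsh1986, Ch. XI] -/
def ConreyLi2000_FW : Prop :=
  ∃ s₀ : ℂ, 1 / 2 < s₀.re ∧ (Literature.NumberTheory.LFunctions.riemannXi s₀ / Literature.NumberTheory.LFunctions.riemannXi (s₀ + 1)).re < 0

/-- Conrey–Li 2000, §3.1 eq. (3.4), the printed numerical witness for `ConreyLi2000_FW`:
`Re{ξ(1 + 282i)/ξ(2 + 282i)} = −0.000131957 < 0` (MATHEMATICA evaluation as printed; the ratio is
the same for the paper's `ξ = 2·Literature.riemannXi`). [cite: ConreyLi2000, §3.1 (3.4)] -/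
def ConreyLi2000_FW_numeric : Prop :=
  (Literature.NumberTheory.LFunctions.riemannXi (1 + 282 * I) / Literature.NumberTheory.LFunctions.riemannXi (2 + 282 * I)).re < 0

/-- The numerical witness (3.4) gives Sarnak's statement with `s₀ = 1 + 282i`. [cite: ConreyLi2000, §3.1] -/
theorem ConreyLi2000_FW_of_numeric (h : ConreyLi2000_FW_numeric) : ConreyLi2000_FW := by
  refine ⟨1 + 282 * I, ?_, ?_⟩
  · norm_num
  · have : (1 : ℂ) + 282 * I + 1 = 2 + 282 * I := by ring
    rw [this]
    exact h

/-- Unfolding: the necessary condition of Conrey–Li's Theorem 2 for `W = 1/ξ(1 − iz)`, written in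
the variable `s = 1 − iz` (`Im z > −1/2 ⟺ Re s > 1/2`, `W(z)/W(z+i) = ξ(s+1)/ξ(s)`), is refuted by
`ConreyLi2000_FW`: `Re u < 0 → Re u⁻¹ < 0`. [cite: ConreyLi2000, Thm. 2 and §3.1] -/
theorem ConreyLi2000_FW.not_necessary (h : ConreyLi2000_FW) :
    ¬ ∀ s : ℂ, 1 / 2 < s.re → 0 ≤ (Literature.NumberTheory.LFunctions.riemannXi (s + 1) / Literature.NumberTheory.LFunctions.riemannXi s).re := by
  obtain ⟨s₀, hs₀, hneg⟩ := h
  intro H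
  have h1 := H s₀ hs₀
  rw [← inv_div, Complex.inv_re] at h1
  have hpos : 0 < Complex.normSq (Literature.NumberTheory.LFunctions.riemannXi s₀ / Literature.NumberTheory.LFunctions.riemannXi (s₀ + 1)) := by
    rw [Complex.normSq_pos]
    intro h0
    rw [h0] at hneg
    simp at hneg
  have := div_nonneg_iff.mp h1
  rcases this with ⟨ha, _⟩ | ⟨_, hb⟩
  · linarith
  · linarith

/-! ## The barrier -/

/-- **Barrier `DeBrangesPositivity` (Conrey–Li 2000).** Both positivity conditions through which
de Branges' Hilbert-space theorems would yield the Riemann hypothesis fail for `ζ`: condition (3.1)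
for `𝓗(E)`, `E(z) = ξ(1 − iz)` (`ConreyLi2000_HE`, via the necessary condition of Theorem 1 at the
34th zero) and condition (3.3) for `𝓕(W)`, `W(z) = 1/ξ(1 − iz)` (`ConreyLi2000_FW`, via the necessary
condition of Theorem 2 and Bohr density; numerical witness `ConreyLi2000_FW_numeric`). "It is
possible that these positivity conditions are too strong for Hilbert spaces of entire functions
associated with the Riemann zeta function and the Dirichlet L-functions" (§4).

BARRIER (structured block, D-0021):
- technique_class: de-Branges-positivity Hilbert-space-of-entire-functions reproducing-kernel-positivity
- blocks: RiemannHypothesis via de Branges' Theorem 1 applied to `E(z) = ξ(1 − iz)` (condition (3.1)) and via de Branges' Theorem 2 applied to `W(z) = 1/ξ(1 − iz)` (condition (3.3) ⟹ `ζ(s) ≠ 0` on `Re s > 1/2`) [cite: ConreyLi2000, §3.1]; the same two routes for `L(s, χ₄)` (§3.2) and, for Theorem 2, for every Dirichlet `L(s, χ)` [cite: ConreyLi2000, §4]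
- because: Theorem 1's hypothesis (3.1) implies `Re{conj(E′(w))E(w+i)/2πi} ≥ 0` at each zero `w` of `E`, negative at the 34th zeta zero [cite: ConreyLi2000, Thm. 1 and §3.1 (3.2)]; Theorem 2's hypothesis (3.3) implies `Re{W(z)/W(z+i)} ≥ 0` on `Im z > −1/2`, contradicted by Bohr density of `log ζ(s)` in `1/2 < Re s < 2` [cite: ConreyLi2000, Thm. 2 and §4 Remark] [cite: Titchmarsh1986, Ch. XI]
- evasions_known: none published for `ζ`; de Branges spaces satisfying the inner-product conditions of de Branges 1986 do exist (Li 2000), and `ξ(1 − iz)` is a de Branges structure function inside the family `E_{h,θ}`, with unconditional simplicity-of-zeros results only for `|h| ≥ 1/2` [cite: Lagarias2005, §7]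
- status: established ((3.2) and (3.4) are numerical evaluations printed in a refereed paper; the `𝓕(W)` failure has Sarnak's non-numerical proof [cite: ConreyLi2000, §4 Remark])
- scope_caveats: refutes the printed sufficient conditions (3.1)/(3.3) only, not every conceivable Hilbert-space-of-entire-functions formulation [cite: ConreyLi2000, §4]

[cite: ConreyLi2000, §3.1 and §4] -/
def DeBrangesPositivity : Prop :=
  ConreyLi2000_HE ∧ ConreyLi2000_FW

/-- The catalogued barrier from its two printed components (the second via the numerical witness
(3.4) or directly). [cite: ConreyLi2000, §3.1] -/
theorem DeBrangesPositivity_of_components (h₁ : ConreyLi2000_HE) (h₂ : ConreyLi2000_FW_numeric) :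
    DeBrangesPositivity :=
  ⟨h₁, ConreyLi2000_FW_of_numeric h₂⟩

end Literature.Barriers.RiemannHypothesis
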